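import Mathlib
import Literature.MathematicalPhysics.QuantumFieldTheory.MullerSchiemann1987.MS87HeatKernelSU2
import HarnessLib

/-!
# Müller–Schiemann, *Continuum limit of a hierarchical SU(2) lattice gauge theory in 4 dimensions*
# (CMP 110, 1987), APPENDIX (A.8) and the large-`γ` bounds (A.10)–(A.11) ON THE REAL AXIS: for `γ ≥ 1`,
# `h(θ) ≤ e^{−γθ² + O(1)}` on `|θ| ≤ π − δ` and `h(π − θ̌) ≤ e^{−γπ(π−2δ) − γθ̌² + O(ln γ)}` on `|θ̌| ≤ δ`,
# with explicit constants, and (v1.1) LEMMA (iv) ON THE REAL AXIS: `h(θ) < exp{−(5/8)β^{1−2α}}` for `β^{−α} < |θ| ≤ π`,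
# `β = γ − 1/6 + ρ₁` large — PROVED (companion of `MS87HeatKernelSU2`, which the gate's 200 kB file limit closes at v1.4)

statement-level skeleton of published theorems with citation tags; proofs where landed; nothing here is a claim about the Yang–Mills mass gap

**Citation header (reproduction of PUBLISHED work).** V. F. Müller, J. Schiemann, *Continuum limit of a hierarchical
SU(2) lattice gauge theory in 4 dimensions*, Commun. Math. Phys. **110** (1987) 261–286, doi 10.1007/BF01207367
[MullerSchiemann1987], APPENDIX, p.285: (A.8) and the bounds (A.10)–(A.11) «valid for γ → ∞» from which part (iv) of the
Appendix Lemma is read off. Loci `p.NNN L.nn` are journal page and text-layer line of the held Project Euclid scan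
`paper:url-96df5da18d4c` (PDF page = journal page − 260); the displays were read on the page render filed by the
lit-balaban YM LIT SWEEP fit-ref B (`inprint/lit-balaban-p18/renders-cmp110ms/g43/hierSU2-1987-cmp110-p025-x2.png`).
Fourth file of the `MullerSchiemann1987/` directory and a direct continuation of `MS87HeatKernelSU2` (v1.4: (A.1)–(A.9),
Lemma (i)–(iii)); everything here is stated for the objects of that file (`h`, `normN'`, `braceT`, `aSeq`, `sSeq`,
`wSeq`) and lives in the same namespace `…MullerSchiemann1987.HeatKernel`. Lean lane of the lit-balaban YM LIT SWEEP
CONTEXT row X1 (register level, zero weight for any token of that table).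

**What the paper prints (verbatim; displays image-read), p.285.**
* (A.8): *«and with θ̌ = π − θ in 𝒟̌ = {θ̌ ∈ ℂ : |Re θ̌| ≤ π − δ}, h(θ) = 𝒩′ (θ̌/sin θ̌) e^{−γθ̌²} Σ_{n=1}^∞
  exp[−4π²γ(n−½)²] · {4π(n−½)θ̌⁻¹ sinh 4πγ(n−½)θ̌ − 2 cosh 4πγ(n−½)θ̌}. (A.8) Both representations are explicitly
  holomorphic in their respective domains.»*
* L.18–21: *«From (A.7) we read off (iii). Moreover we deduce from (A.7) and (A.8) bounds, valid for γ → ∞,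
  |h(θ)| ≤ exp{−γ Re θ² + 𝒪(1)}, θ ∈ 𝒟, (A.10)   |h(θ)| ≤ exp{−γπ(π − 2δ) − γ Re θ̌² + 𝒪(ln γ)}, |Re θ̌| ≤ δ. (A.11)
  From these bounds follows (iv) observing that p < 1 − κ²/4 + 𝒪(β^{−1+2α}). ∎»* (`𝒟 = {θ ∈ ℂ : |Re θ| ≤ π − δ}`,
  «δ > 0 small», p.285 L.9–10.)
* LEMMA (iv), p.284 (as quoted in `MS87HeatKernelSU2`): *«(iv) In {|θ| > β^{−α}, |Re θ| ≤ π, |Im θ| < (κ/2)β^{−α}},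
  |h(θ)| < exp{β(Im θ)² − pβ^{1−2α}} with a constant p = 5/8 and β := γ − 1/6 + ρ₁ large enough.»* (`α`, `κ` are the
  fixed parameters of Sect. 3, (3.5): `3/7 ≤ α < 1/2`, `(8(1−p))^{1/2} < κ < 2·3^{−1/2}`.)

**What is reproduced here (kernel-checked: zero `sorry`, zero named facts, axioms standard) — ON THE REAL AXIS.**
* §1 — plumbing: the first-moment periodised Gaussian `Σ_{n∈ℤ}(θ − 2πn)e^{−γ(θ−2πn)²}` is summable for every real `θ`
  (`summable_periodicMoment`, via Mathlib's `hasSum_jacobiTheta₂_term` / `hasSum_jacobiTheta₂'_term` at imaginary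
  arguments, as in `MS87HeatKernelSU2` §10), `cosh x ≤ e^{|x|}`; §2 adds `|sinh y| ≤ |y| cosh y` (termwise from the
  power series) and Jordan's `θ/sin θ ≤ π²/(2δ)` on `(0, π − δ]`.
* §2 — **(A.10) on the real axis, uniformly in `γ ≥ 1`**: for `0 < δ < π`, `γ ≥ 1`, `|θ| ≤ π − δ`,
  **`h(θ) ≤ (π²/δ)(1 + 2M(δ)) e^{−γθ²}`** (`h_le_A10`; `M(δ) = Σ_{n≥0}(1 + 4π(n+1)²/δ)e^{−2πδ(n+1)}`, `MA10`), i.e.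
  `h(θ) ≤ exp(−γθ² + A(δ))` (`h_le_exp_A10`): from (A.7) (`h_mul_sin_eq_braceT`: `h sin θ = 𝒩′e^{−γθ²}(θ + 2T(θ))`),
  the termwise estimate `|θ cosh(a_nθ) − 2π(n+1) sinh(a_nθ)| w_n ≤ θ(1 + 4π(n+1)²/δ)e^{−2πδ(n+1)}` (because
  `a_nθ − 4π²γ(n+1)² = −4πγ(n+1)(π(n+1) − θ) ≤ −4πγδ(n+1)` and `γe^{−2πδγ} ≤ 1/(2πδ)`), hence `|T(θ)| ≤ θM(δ)`, then
  `𝒩′ ≤ 2` (`normN'_le_two`, (A.9)) and `θ/sin θ ≤ π²/(2δ)`; `h` is even.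
* §3 — **(A.8) explicitly**, real `θ̌`: **`h(π − θ̌) sin θ̌ = 𝒩′e^{−γθ̌²}·2Σ_{n≥0}[2π(n+½) sinh(4πγ(n+½)θ̌) −
  θ̌ cosh(4πγ(n+½)θ̌)]e^{−4π²γ(n+½)²}`** (`h_mul_sin_eq_A8`) — the printed (A.8) multiplied by `sin θ̌`, index shifted to
  start at `0` — from the periodised form (`h_mul_sin_eq_periodicGaussian` at `θ = π − θ̌`, `sin(π − θ̌) = sin θ̌`) by
  pairing the terms `n + 1` and `−n`; `summable_A8_term`.
* §4 — **(A.11) on the real axis, uniformly in `γ ≥ 1`**: for `0 < δ ≤ π/2`, `γ ≥ 1`, `|θ̌| ≤ δ`,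
  **`h(π − θ̌) ≤ 2π((1 + 2π²γ) + M₁₁) e^{−γπ(π−2δ) − γθ̌²}`** (`h_le_A11`; `M₁₁ = Σ_{n≥0}(1 + 8π²(n+3/2)²)e^{−π²(n+1)}`,
  `MA11`), i.e. `h(π − θ̌) ≤ exp(−γπ(π−2δ) − γθ̌² + log(A + Bγ))` (`h_le_exp_A11`) — the `𝒪(ln γ)` is the weight
  `1 + 2π²γ` of the `n = ½` term: from (A.8), `4πγm|θ̌| − 4π²γm² ≤ −γπ(π−2δ) − 2π²nγ` (`m = n + ½`, using `δ ≤ π/2`),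
  `γe^{−2π²nγ} ≤ e^{−π²n}` (`n ≥ 1`), `𝒩′ ≤ 2`, Jordan's `|θ̌| ≤ (π/2)|sin θ̌|`, and at `θ̌ = 0` the strict decrease
  `h(π) < h(π − δ)` (Lemma (ii), `h_strictAntiOn`).
* §5 (v1.1) — **LEMMA (iv) ON THE REAL AXIS** (`h_lt_exp_iv_real`): for `0 < α < 1/2` there is `γ₀` such that for all
  `γ ≥ γ₀`, with **`β = γ − 1/6 + ρ₁(γ)`** (`betaIV`), every real `θ` with `β^{−α} < |θ| ≤ π` satisfies
  **`h(θ) < exp{−(5/8)β^{1−2α}}`** — the printed (iv) at `Im θ = 0`. Proof as the print says («From these bounds follows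
  (iv)»): `ρ₁(γ) → 0` (`tendsto_rho1_zero`, from `abs_rho1_le`), so eventually `γ − 1/3 ≤ β ≤ γ`; on `|θ| ≤ 3π/4`, (A.10)
  gives `h ≤ e^{A − γθ²} < e^{A − γβ^{−2α}} ≤ e^{A − β^{1−2α}} ≤ e^{−(5/8)β^{1−2α}}` once `(3/8)β^{1−2α} ≥ A`; on
  `3π/4 < |θ| ≤ π`, (A.11) with `δ = π/4` gives `h ≤ e^{−γπ²/2 + log(A′ + B′γ)} < e^{−(5/8)γ} ≤ e^{−(5/8)β^{1−2α}}` for `γ`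
  large (`log(A′ + B′γ) ≤ log B′ + A′/B′ + γ − 1`, `β^{1−2α} ≤ β ≤ γ`).

**Readings (declared).** (a) The print states (A.8), (A.10), (A.11) for COMPLEX arguments in the strips `𝒟̌`, `𝒟`,
`{|Re θ̌| ≤ δ}`; here `θ`, `θ̌` are REAL (`h > 0` on `ℝ`, so `|h| = h`) — TODO(general form): the strips, which is what
part (iv) of the Lemma needs. (b) «valid for γ → ∞» is realised as: for all `γ ≥ 1`, with the `𝒪(1)` / `𝒪(ln γ)`
made explicit and independent of `γ`; the threshold `1` is a choice (it is where (A.9)'s `𝒩′ ≤ 2` is available).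
(c) «δ > 0 small»: §2 takes any `0 < δ < π`, §4 takes `0 < δ ≤ π/2` (Jordan's inequality on `[0, π/2]`).
(d) §5: «β large enough» is realised as «`γ ≥ γ₀`» for a threshold `γ₀` depending on `α` (equivalent, since
`|β − γ + 1/6| = |ρ₁| → 0`); the print's `3/7 ≤ α` (needed elsewhere in Sect. 3) is relaxed to `0 < α`; on the real axis
the factor `e^{β(Im θ)²}` is `1` and `κ` plays no role.

**Not claimed.** (A.8), (A.10), (A.11) and part (iv) off the real axis (the strips `𝒟`, `𝒟̌`, `{|Im θ| < (κ/2)β^{−α}}`);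
an explicit `γ₀` in §5; the induction hypotheses (A₁)–(A₃); (A.10)–(A.11) for `γ < 1`; anything about the Wilson action,
the Migdal recursion, or lattice Yang–Mills.

**v1.1 (p12 gen 18): APPEND-ONLY — §§1–4 byte-identical to v1.0 (p341069); + §5 Lemma (iv) on the real axis.**
-/

noncomputable section

open Real Filter Topology Set

namespace Literature.MathematicalPhysics.QuantumFieldTheory

namespace MullerSchiemann1987

namespace HeatKernel

/-! ## §1 Plumbing: summability of the periodised moment series; `cosh ≤ e^{|·|}` -/

section Plumbing

variable {γ : ℝ}

/-- `ϑ`-terms at imaginary arguments are real: `e^{2πin(iy) + πin²(iT)} = e^{−(2πny + πn²T)}` (as in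
`MS87HeatKernelSU2` §10, whose copy is private). [folklore] -/
private theorem jacobiTheta₂_term_I' (n : ℤ) (y T : ℝ) :
    jacobiTheta₂_term n (y * Complex.I) (T * Complex.I) =
      ((Real.exp (-(2 * π * n * y + π * n ^ 2 * T)) : ℝ) : ℂ) := by
  rw [jacobiTheta₂_term, Complex.ofReal_exp]
  congr 1
  push_cast
  linear_combination (2 * ↑π * (n : ℂ) * (y : ℂ) + ↑π * (n : ℂ) ^ 2 * (T : ℂ)) * Complex.I_mul_I

/-- `0 < Im(iT)` for `T > 0`. [folklore] -/
private theorem im_T_I_pos' {T : ℝ} (hT : 0 < T) : 0 < (T * Complex.I : ℂ).im := by simpa using hT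

/-- The real series `Σₙ e^{−(2πny + πn²T)}` converges (`T > 0`). [folklore] -/
private theorem summable_exp_I' (y : ℝ) {T : ℝ} (hT : 0 < T) :
    Summable fun n : ℤ => Real.exp (-(2 * π * n * y + π * n ^ 2 * T)) := by
  have h := (hasSum_jacobiTheta₂_term (y * Complex.I) (im_T_I_pos' hT)).summable
  simp_rw [jacobiTheta₂_term_I'] at h
  exact Complex.summable_ofReal.mp h

/-- The real series `Σₙ n e^{−(2πny + πn²T)}` converges (`T > 0`). [folklore] -/
private theorem summable_int_mul_exp_I' (y : ℝ) {T : ℝ} (hT : 0 < T) :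
    Summable fun n : ℤ => (n : ℝ) * Real.exp (-(2 * π * n * y + π * n ^ 2 * T)) := by
  have h := (hasSum_jacobiTheta₂'_term (y * Complex.I) (im_T_I_pos' hT)).summable
  have h' : Summable fun n : ℤ => (2 * π * Complex.I) *
      ((((n : ℝ) * Real.exp (-(2 * π * n * y + π * n ^ 2 * T))) : ℝ) : ℂ) := by
    refine h.congr fun n => ?_
    rw [jacobiTheta₂'_term, jacobiTheta₂_term_I']
    push_cast
    ring
  have h2 : (2 * π * Complex.I : ℂ) ≠ 0 :=
    mul_ne_zero (mul_ne_zero two_ne_zero (Complex.ofReal_ne_zero.mpr Real.pi_ne_zero)) Complex.I_ne_zero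
  exact Complex.summable_ofReal.mp ((summable_mul_left_iff h2).mp h')

/-- The series of (A.7) with the square expanded: `Σ_{n∈ℤ} (θ − 2πn) e^{4πγnθ − 4π²γn²}` converges. [folklore] -/
private theorem summable_moment_expanded' (hγ : 0 < γ) (θ : ℝ) :
    Summable fun n : ℤ => (θ - 2 * π * n) * Real.exp (4 * π * γ * n * θ - 4 * π ^ 2 * γ * n ^ 2) := by
  have hs₀ := summable_exp_I' (-(2 * γ * θ)) (by positivity : 0 < 4 * π * γ)
  have hs₁ := summable_int_mul_exp_I' (-(2 * γ * θ)) (by positivity : 0 < 4 * π * γ)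
  refine ((hs₀.mul_left θ).sub (hs₁.mul_left (2 * π))).congr fun n => ?_
  have hE : -(2 * π * (n : ℝ) * (-(2 * γ * θ)) + π * (n : ℝ) ^ 2 * (4 * π * γ))
      = 4 * π * γ * n * θ - 4 * π ^ 2 * γ * n ^ 2 := by ring
  rw [hE]
  ring

/-- `e^{−γ(θ−2πn)²} = e^{−γθ²} e^{4πγnθ − 4π²γn²}`. [folklore] -/
private theorem exp_periodic_eq' (γ θ : ℝ) (n : ℤ) :
    Real.exp (-(γ * (θ - 2 * π * n) ^ 2)) =
      Real.exp (-(γ * θ ^ 2)) * Real.exp (4 * π * γ * n * θ - 4 * π ^ 2 * γ * n ^ 2) := by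
  rw [← Real.exp_add]
  congr 1
  ring

/-- The first-moment periodised Gaussian `Σ_{n∈ℤ}(θ − 2πn)e^{−γ(θ−2πn)²}` (the series of (A.7)/(A.8),
`h_mul_sin_eq_periodicGaussian`) is summable for every real `θ`. [cite: MullerSchiemann1987, Appendix (A.7)–(A.8) p.285] -/
theorem summable_periodicMoment (hγ : 0 < γ) (θ : ℝ) :
    Summable fun n : ℤ => (θ - 2 * π * n) * Real.exp (-(γ * (θ - 2 * π * n) ^ 2)) := by
  have h := (summable_moment_expanded' hγ θ).mul_left (Real.exp (-(γ * θ ^ 2)))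
  refine h.congr fun n => ?_
  rw [exp_periodic_eq']
  ring

/-- `cosh x ≤ e^{|x|}`. [folklore] -/
private theorem cosh_le_exp_abs (x : ℝ) : Real.cosh x ≤ Real.exp |x| := by
  rw [Real.cosh_eq]
  have h1 : Real.exp x ≤ Real.exp |x| := Real.exp_le_exp.mpr (le_abs_self x)
  have h2 : Real.exp (-x) ≤ Real.exp |x| := Real.exp_le_exp.mpr (neg_le_abs x)
  linarith

end Plumbing

/-! ## §2 (A.10) on the real axis: `h(θ) ≤ e^{−γθ² + O(1)}` for `|θ| ≤ π − δ`, uniformly in `γ ≥ 1` -/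

section A10

variable {γ : ℝ}

/-- `sinh y ≤ y cosh y` for `y ≥ 0` (termwise from the power series: `y^{2n+1}/(2n+1)! ≤ y · y^{2n}/(2n)!`). [folklore] -/
private theorem sinh_le_mul_cosh {y : ℝ} (hy : 0 ≤ y) : Real.sinh y ≤ y * Real.cosh y := by
  have hs := Real.hasSum_sinh y
  have hc := (Real.hasSum_cosh y).mul_left y
  refine hasSum_le (fun n => ?_) hs hc
  have hf1 : (0 : ℝ) < ((2 * n).factorial : ℝ) := by exact_mod_cast Nat.factorial_pos _
  have hf2 : (0 : ℝ) < ((2 * n + 1).factorial : ℝ) := by exact_mod_cast Nat.factorial_pos _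
  have hfle : (((2 * n).factorial : ℕ) : ℝ) ≤ ((2 * n + 1).factorial : ℕ) := by
    exact_mod_cast Nat.factorial_le (by omega)
  rw [pow_succ, div_le_iff₀ hf2]
  calc y ^ (2 * n) * y = y * (y ^ (2 * n) / ((2 * n).factorial : ℝ)) * ((2 * n).factorial : ℝ) := by
        field_simp
    _ ≤ y * (y ^ (2 * n) / ((2 * n).factorial : ℝ)) * ((2 * n + 1).factorial : ℝ) :=
        mul_le_mul_of_nonneg_left hfle (by positivity)

/-- `|sinh y| ≤ |y| cosh y` for every real `y`. [folklore] -/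
private theorem abs_sinh_le_abs_mul_cosh (y : ℝ) : |Real.sinh y| ≤ |y| * Real.cosh y := by
  rcases le_or_gt 0 y with hy | hy
  · rw [abs_of_nonneg (Real.sinh_nonneg_iff.mpr hy), abs_of_nonneg hy]
    exact sinh_le_mul_cosh hy
  · have h := sinh_le_mul_cosh (neg_nonneg.mpr hy.le)
    rw [Real.sinh_neg, Real.cosh_neg] at h
    rw [abs_of_neg (Real.sinh_neg_iff.mpr hy), abs_of_neg hy]
    linarith

/-- `θ/sin θ ≤ π²/(2δ)` for `0 < θ ≤ π − δ` (`0 < δ < π`), from Jordan's inequality `sin x ≥ (2/π)x` on `[0, π/2]`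
applied to `θ` and to `π − θ`. [folklore] -/
private theorem div_sin_le {δ θ : ℝ} (hδ : 0 < δ) (hδπ : δ < π) (hθ0 : 0 < θ) (hθ : θ ≤ π - δ) :
    θ / Real.sin θ ≤ π ^ 2 / (2 * δ) := by
  have hπ : 0 < π := Real.pi_pos
  have hsinpos : 0 < Real.sin θ := Real.sin_pos_of_pos_of_lt_pi hθ0 (by linarith)
  rw [div_le_div_iff₀ hsinpos (by positivity)]
  rcases le_or_gt θ (π / 2) with h1 | h1
  · -- sin θ ≥ (2/π) θ, so θ · 2δ ≤ θ · 2π... use θ ≤ π/2 and δ < π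
    have hj := Real.mul_le_sin hθ0.le h1
    -- θ * (2δ) ≤ π² sin θ  ⟸  θ * 2δ ≤ θ * 2π ≤ π² · (2/π) θ = 2π θ
    have h2 : θ * (2 * δ) ≤ 2 * π * θ := by nlinarith
    have h3 : 2 * π * θ = π ^ 2 * (2 / π * θ) := by field_simp
    calc θ * (2 * δ) ≤ 2 * π * θ := h2
      _ = π ^ 2 * (2 / π * θ) := h3
      _ ≤ π ^ 2 * Real.sin θ := mul_le_mul_of_nonneg_left hj (by positivity)
  · -- sin θ = sin (π − θ) ≥ (2/π)(π − θ) ≥ (2/π) δ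
    have hj := Real.mul_le_sin (x := π - θ) (by linarith) (by linarith)
    rw [Real.sin_pi_sub] at hj
    have h2 : 2 / π * δ ≤ 2 / π * (π - θ) := mul_le_mul_of_nonneg_left (by linarith) (by positivity)
    have h4 : θ ≤ π := by linarith
    calc θ * (2 * δ) ≤ π * (2 * δ) := by nlinarith
      _ = π ^ 2 * (2 / π * δ) := by field_simp
      _ ≤ π ^ 2 * Real.sin θ := mul_le_mul_of_nonneg_left (h2.trans hj) (by positivity)

/-- The `δ`-dependent constant of the real-axis (A.10): `M(δ) = Σ_{n≥0} (1 + 4π(n+1)²/δ) e^{−2πδ(n+1)}`. [folklore] -/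
noncomputable def MA10 (δ : ℝ) : ℝ := ∑' n : ℕ, (1 + 4 * π * ((n : ℝ) + 1) ^ 2 / δ) * Real.exp (-(2 * π * δ * ((n : ℝ) + 1)))

/-- The series `M(δ)` converges (`δ > 0`). [folklore] -/
private theorem summable_MA10_term {δ : ℝ} (hδ : 0 < δ) :
    Summable fun n : ℕ => (1 + 4 * π * ((n : ℝ) + 1) ^ 2 / δ) * Real.exp (-(2 * π * δ * ((n : ℝ) + 1))) := by
  have hr : 0 < 2 * π * δ := by positivity
  have h0 := (summable_nat_add_iff 1).mpr (Real.summable_pow_mul_exp_neg_nat_mul 0 hr)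
  have h2 := (summable_nat_add_iff 1).mpr (Real.summable_pow_mul_exp_neg_nat_mul 2 hr)
  refine ((h0).add (h2.mul_left (4 * π / δ))).congr fun n => ?_
  push_cast
  ring_nf

/-- `M(δ) ≥ 0`. [folklore] -/
private theorem MA10_nonneg {δ : ℝ} (hδ : 0 < δ) : 0 ≤ MA10 δ := by
  unfold MA10
  exact tsum_nonneg fun n => by positivity

/-- The termwise estimate behind (A.10) on the real axis: for `γ ≥ 1`, `0 ≤ θ ≤ π − δ`,
`|θ cosh(a_nθ) − 2π(n+1) sinh(a_nθ)| w_n ≤ θ (1 + 4π(n+1)²/δ) e^{−2πδ(n+1)}` — because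
`a_nθ − 4π²γ(n+1)² = −4πγ(n+1)(π(n+1) − θ) ≤ −4πγδ(n+1)` and `γe^{−2πδγ(n+1)}·8π²(n+1)² ≤ 4π(n+1)²/δ · e^{0}`…
[cite: MullerSchiemann1987, Appendix (A.10) p.285] -/
private theorem abs_brace_term_le_A10 (hγ : 1 ≤ γ) {δ θ : ℝ} (hδ : 0 < δ) (hθ0 : 0 ≤ θ) (hθ : θ ≤ π - δ)
    (n : ℕ) :
    |(θ * Real.cosh (aSeq γ n * θ) - 2 * π * (n + 1) * Real.sinh (aSeq γ n * θ)) * wSeq γ n|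
      ≤ θ * ((1 + 4 * π * ((n : ℝ) + 1) ^ 2 / δ) * Real.exp (-(2 * π * δ * ((n : ℝ) + 1)))) := by
  have hπ : 0 < π := Real.pi_pos
  have hγ0 : 0 < γ := by linarith
  have ha := aSeq_pos hγ0 n
  have hw := wSeq_pos γ n
  have hn1 : (1 : ℝ) ≤ (n : ℝ) + 1 := by have : (0:ℝ) ≤ n := n.cast_nonneg; linarith
  have hy : 0 ≤ aSeq γ n * θ := by positivity
  -- |term| ≤ θ (1 + s_n) cosh(a θ) w
  have h1 : |(θ * Real.cosh (aSeq γ n * θ) - 2 * π * (n + 1) * Real.sinh (aSeq γ n * θ)) * wSeq γ n|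
      ≤ θ * (1 + sSeq γ n) * Real.cosh (aSeq γ n * θ) * wSeq γ n := by
    rw [abs_mul, abs_of_pos hw]
    refine mul_le_mul_of_nonneg_right ?_ hw.le
    have hs : |Real.sinh (aSeq γ n * θ)| ≤ aSeq γ n * θ * Real.cosh (aSeq γ n * θ) := by
      have := abs_sinh_le_abs_mul_cosh (aSeq γ n * θ)
      rwa [abs_of_nonneg hy] at this
    have hnn : (0 : ℝ) ≤ 2 * π * ((n : ℝ) + 1) := by positivity
    calc |θ * Real.cosh (aSeq γ n * θ) - 2 * π * (n + 1) * Real.sinh (aSeq γ n * θ)|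
        ≤ |θ * Real.cosh (aSeq γ n * θ)| + |2 * π * (n + 1) * Real.sinh (aSeq γ n * θ)| := abs_sub _ _
      _ = θ * Real.cosh (aSeq γ n * θ) + 2 * π * (n + 1) * |Real.sinh (aSeq γ n * θ)| := by
          rw [abs_mul, abs_of_nonneg hθ0, abs_of_pos (Real.cosh_pos _), abs_mul, abs_of_nonneg hnn]
      _ ≤ θ * Real.cosh (aSeq γ n * θ) + 2 * π * (n + 1) * (aSeq γ n * θ * Real.cosh (aSeq γ n * θ)) := by
          gcongr
      _ = θ * (1 + sSeq γ n) * Real.cosh (aSeq γ n * θ) := by rw [← two_pi_mul_aSeq]; ring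
  -- cosh(aθ) w ≤ e^{aθ} w ≤ e^{−4πγδ(n+1)}
  have h2 : Real.cosh (aSeq γ n * θ) * wSeq γ n ≤ Real.exp (-(4 * π * γ * δ * ((n : ℝ) + 1))) := by
    have hc : Real.cosh (aSeq γ n * θ) ≤ Real.exp (aSeq γ n * θ) := by
      have := cosh_le_exp_abs (aSeq γ n * θ); rwa [abs_of_nonneg hy] at this
    calc Real.cosh (aSeq γ n * θ) * wSeq γ n ≤ Real.exp (aSeq γ n * θ) * wSeq γ n :=
          mul_le_mul_of_nonneg_right hc hw.le
      _ = Real.exp (aSeq γ n * θ + -(4 * π ^ 2 * γ * ((n : ℝ) + 1) ^ 2)) := by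
          rw [Real.exp_add]; rfl
      _ ≤ Real.exp (-(4 * π * γ * δ * ((n : ℝ) + 1))) := by
          apply Real.exp_le_exp.mpr
          rw [aSeq]
          -- 4πγ(n+1)θ − 4π²γ(n+1)² = −4πγ(n+1)(π(n+1) − θ) ≤ −4πγ(n+1)δ
          have hk : δ ≤ π * ((n : ℝ) + 1) - θ := by nlinarith
          have hpos : 0 ≤ 4 * π * γ * ((n : ℝ) + 1) := by positivity
          nlinarith [mul_le_mul_of_nonneg_left hk hpos]
  -- (1 + s_n) e^{−4πγδ(n+1)} ≤ (1 + 4π(n+1)²/δ) e^{−2πδ(n+1)}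
  have h3 : (1 + sSeq γ n) * Real.exp (-(4 * π * γ * δ * ((n : ℝ) + 1)))
      ≤ (1 + 4 * π * ((n : ℝ) + 1) ^ 2 / δ) * Real.exp (-(2 * π * δ * ((n : ℝ) + 1))) := by
    -- split the exponential
    have hsplit : Real.exp (-(4 * π * γ * δ * ((n : ℝ) + 1)))
        ≤ Real.exp (-(2 * π * δ * γ)) * Real.exp (-(2 * π * δ * ((n : ℝ) + 1))) := by
      rw [← Real.exp_add]
      apply Real.exp_le_exp.mpr
      have hprod : 2 * π * δ * γ + 2 * π * δ * ((n : ℝ) + 1) ≤ 4 * π * γ * δ * ((n : ℝ) + 1) := by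
        nlinarith [mul_nonneg (mul_nonneg (by positivity : (0:ℝ) ≤ 2 * π * δ) (sub_nonneg.mpr hγ))
          (sub_nonneg.mpr hn1), mul_nonneg (by positivity : (0:ℝ) ≤ 2 * π * δ) (sub_nonneg.mpr hn1),
          mul_nonneg (by positivity : (0:ℝ) ≤ 2 * π * δ) (sub_nonneg.mpr hγ)]
      linarith
    -- γ e^{−2πδγ} ≤ 1/(2πδ)
    have hγexp : γ * Real.exp (-(2 * π * δ * γ)) ≤ 1 / (2 * π * δ) := by
      have hpos : 0 < 2 * π * δ := by positivity
      have h := Real.add_one_le_exp (2 * π * δ * γ)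
      rw [Real.exp_neg, ← div_eq_mul_inv, div_le_div_iff₀ (Real.exp_pos _) hpos]
      nlinarith [Real.exp_pos (2 * π * δ * γ)]
    have he1 : Real.exp (-(2 * π * δ * γ)) ≤ 1 := by
      rw [Real.exp_le_one_iff]; have : 0 ≤ 2 * π * δ * γ := by positivity
      linarith
    have hE0 : 0 ≤ Real.exp (-(2 * π * δ * ((n : ℝ) + 1))) := (Real.exp_pos _).le
    have hs0 : 0 ≤ 1 + sSeq γ n := by have := sSeq_pos hγ0 n; linarith
    calc (1 + sSeq γ n) * Real.exp (-(4 * π * γ * δ * ((n : ℝ) + 1)))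
        ≤ (1 + sSeq γ n) * (Real.exp (-(2 * π * δ * γ)) * Real.exp (-(2 * π * δ * ((n : ℝ) + 1)))) :=
          mul_le_mul_of_nonneg_left hsplit hs0
      _ = (Real.exp (-(2 * π * δ * γ)) + 8 * π ^ 2 * ((n : ℝ) + 1) ^ 2 * (γ * Real.exp (-(2 * π * δ * γ))))
            * Real.exp (-(2 * π * δ * ((n : ℝ) + 1))) := by rw [sSeq]; ring
      _ ≤ (1 + 8 * π ^ 2 * ((n : ℝ) + 1) ^ 2 * (1 / (2 * π * δ))) * Real.exp (-(2 * π * δ * ((n : ℝ) + 1))) := by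
          gcongr
      _ = (1 + 4 * π * ((n : ℝ) + 1) ^ 2 / δ) * Real.exp (-(2 * π * δ * ((n : ℝ) + 1))) := by
          field_simp
          ring
  calc _ ≤ θ * (1 + sSeq γ n) * Real.cosh (aSeq γ n * θ) * wSeq γ n := h1
    _ = θ * ((1 + sSeq γ n) * (Real.cosh (aSeq γ n * θ) * wSeq γ n)) := by ring
    _ ≤ θ * ((1 + sSeq γ n) * Real.exp (-(4 * π * γ * δ * ((n : ℝ) + 1)))) := by
        have hs0 : 0 ≤ 1 + sSeq γ n := by have := sSeq_pos hγ0 n; linarith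
        exact mul_le_mul_of_nonneg_left (mul_le_mul_of_nonneg_left h2 hs0) hθ0
    _ ≤ θ * ((1 + 4 * π * ((n : ℝ) + 1) ^ 2 / δ) * Real.exp (-(2 * π * δ * ((n : ℝ) + 1)))) :=
        mul_le_mul_of_nonneg_left h3 hθ0

/-- `|T(θ)| ≤ θ·M(δ)` for `γ ≥ 1`, `0 ≤ θ ≤ π − δ`. [cite: MullerSchiemann1987, Appendix (A.10) p.285] -/
private theorem abs_braceT_le_A10 (hγ : 1 ≤ γ) {δ θ : ℝ} (hδ : 0 < δ) (hθ0 : 0 ≤ θ) (hθ : θ ≤ π - δ) :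
    |braceT γ θ| ≤ θ * MA10 δ := by
  have hγ0 : 0 < γ := by linarith
  have hM := (summable_MA10_term hδ).mul_left θ
  have h := tsum_of_norm_bounded hM.hasSum
    (fun n => (Real.norm_eq_abs _).le.trans (abs_brace_term_le_A10 hγ hδ hθ0 hθ n))
  rw [Real.norm_eq_abs, tsum_mul_left] at h
  exact h

/-- **(A.10) on the real axis, uniformly in `γ ≥ 1`, explicit:** for `0 < δ < π`, `γ ≥ 1` and `|θ| ≤ π − δ`,
`h(θ) ≤ (π²/δ)(1 + 2M(δ)) · e^{−γθ²}` — the print's «|h(θ)| ≤ exp{−γ Re θ² + O(1)}, θ ∈ 𝒟 = {|Re θ| ≤ π − δ}»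
(valid for `γ → ∞`) restricted to real `θ` (`h > 0`, so `|h| = h`), with the `O(1)` made explicit and uniform in
`γ ≥ 1`. Proof from (A.7): `h = 𝒩′e^{−γθ²}(θ + 2T(θ))/sin θ`, `|T(θ)| ≤ θM(δ)` (`a_nθ − 4π²γn² ≤ −4πγnδ`), `𝒩′ ≤ 2`,
and `θ/sin θ ≤ π²/(2δ)` (Jordan). [cite: MullerSchiemann1987, Appendix (A.10) p.285] -/
theorem h_le_A10 (hγ : 1 ≤ γ) {δ : ℝ} (hδ : 0 < δ) (hδπ : δ < π) {θ : ℝ} (hθ : |θ| ≤ π - δ) :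
    h γ θ ≤ π ^ 2 / δ * (1 + 2 * MA10 δ) * Real.exp (-(γ * θ ^ 2)) := by
  have hπ : 0 < π := Real.pi_pos
  have hγ0 : 0 < γ := by linarith
  have hM0 := MA10_nonneg hδ
  have hN := normN'_le_two hγ
  have hN0 : 0 < normN' γ := by rw [normN']; exact mul_pos (by positivity) (normN_pos hγ0)
  -- reduce to θ ≥ 0 by evenness
  wlog hθ0 : 0 ≤ θ generalizing θ with H
  · have h1 := H (θ := -θ) (by rwa [abs_neg]) (by linarith [le_of_lt (not_le.mp hθ0)])
    rw [h_neg hγ0] at h1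
    simpa using h1
  rcases hθ0.eq_or_lt with rfl | hθpos
  · -- θ = 0
    rw [h_zero hγ0]
    simp only [ne_eq, OfNat.ofNat_ne_zero, not_false_eq_true, zero_pow, mul_zero, neg_zero,
      Real.exp_zero, mul_one]
    have h1 : (1 : ℝ) ≤ π ^ 2 / δ := by
      rw [le_div_iff₀ hδ]; nlinarith [Real.pi_gt_three]
    nlinarith
  · have hθ' : θ ≤ π - δ := (le_abs_self θ).trans hθ
    have hsinpos : 0 < Real.sin θ := Real.sin_pos_of_pos_of_lt_pi hθpos (by linarith)
    have hA7 := h_mul_sin_eq_braceT hγ0 θ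
    have hT := abs_braceT_le_A10 hγ hδ hθpos.le hθ'
    have hq := div_sin_le hδ hδπ hθpos hθ'
    -- h = 𝒩′ e^{-γθ²} (θ + 2T)/sin θ
    have heq : h γ θ = normN' γ * Real.exp (-(γ * θ ^ 2)) * (θ + 2 * braceT γ θ) / Real.sin θ := by
      rw [← hA7]; field_simp
    rw [heq, div_le_iff₀ hsinpos]
    have hb : θ + 2 * braceT γ θ ≤ θ * (1 + 2 * MA10 δ) := by
      have := (le_abs_self (braceT γ θ)).trans hT
      nlinarith
    have hE : 0 < Real.exp (-(γ * θ ^ 2)) := Real.exp_pos _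
    calc normN' γ * Real.exp (-(γ * θ ^ 2)) * (θ + 2 * braceT γ θ)
        ≤ 2 * Real.exp (-(γ * θ ^ 2)) * (θ * (1 + 2 * MA10 δ)) := by
          have h0 : normN' γ * Real.exp (-(γ * θ ^ 2)) * (θ + 2 * braceT γ θ)
              ≤ normN' γ * Real.exp (-(γ * θ ^ 2)) * (θ * (1 + 2 * MA10 δ)) :=
            mul_le_mul_of_nonneg_left hb (by positivity)
          have h1 : normN' γ * Real.exp (-(γ * θ ^ 2)) * (θ * (1 + 2 * MA10 δ))
              ≤ 2 * Real.exp (-(γ * θ ^ 2)) * (θ * (1 + 2 * MA10 δ)) := by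
            have : 0 ≤ Real.exp (-(γ * θ ^ 2)) * (θ * (1 + 2 * MA10 δ)) := by positivity
            nlinarith
          exact h0.trans h1
      _ = 2 * (1 + 2 * MA10 δ) * Real.exp (-(γ * θ ^ 2)) * θ := by ring
      _ ≤ 2 * (1 + 2 * MA10 δ) * Real.exp (-(γ * θ ^ 2)) * (π ^ 2 / (2 * δ) * Real.sin θ) := by
          have hθle : θ ≤ π ^ 2 / (2 * δ) * Real.sin θ := by rwa [div_le_iff₀ hsinpos] at hq
          exact mul_le_mul_of_nonneg_left hθle (by positivity)
      _ = π ^ 2 / δ * (1 + 2 * MA10 δ) * Real.exp (-(γ * θ ^ 2)) * Real.sin θ := by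
          field_simp

/-- (A.10) on the real axis in the printed shape `|h(θ)| ≤ exp{−γθ² + O(1)}`: there is a constant `A = A(δ)` with
`h(θ) ≤ exp(−γθ² + A)` for all `γ ≥ 1`, `|θ| ≤ π − δ`. [cite: MullerSchiemann1987, Appendix (A.10) p.285] -/
theorem h_le_exp_A10 {δ : ℝ} (hδ : 0 < δ) (hδπ : δ < π) : ∃ A : ℝ, ∀ γ : ℝ, 1 ≤ γ → ∀ θ : ℝ, |θ| ≤ π - δ →
    h γ θ ≤ Real.exp (-(γ * θ ^ 2) + A) := by
  have hπ : 0 < π := Real.pi_pos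
  have hM0 := MA10_nonneg hδ
  have hC : 0 < π ^ 2 / δ * (1 + 2 * MA10 δ) := by positivity
  refine ⟨Real.log (π ^ 2 / δ * (1 + 2 * MA10 δ)), fun γ hγ θ hθ => ?_⟩
  rw [Real.exp_add, Real.exp_log hC, mul_comm]
  exact h_le_A10 hγ hδ hδπ hθ

end A10


/-! ## §3 (A.8) explicitly: the periodised Gaussian re-centred at `θ = π` -/

section A8

variable {γ : ℝ}

/-- **(A.8) for real `θ̌ = π − θ` (multiplied by `sin θ̌`)**:
`h(π − θ̌) sin θ̌ = 𝒩′ e^{−γθ̌²} · 2Σ_{n≥0} [2π(n+½) sinh(4πγ(n+½)θ̌) − θ̌ cosh(4πγ(n+½)θ̌)] e^{−4π²γ(n+½)²}`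
— the print's `h(θ) = 𝒩′(θ̌/sin θ̌)e^{−γθ̌²}Σ_{n≥1} exp[−4π²γ(n−½)²]{4π(n−½)θ̌⁻¹ sinh 4πγ(n−½)θ̌ − 2cosh 4πγ(n−½)θ̌}`
(index shifted to start at `0`), obtained from the periodised form (`h_mul_sin_eq_periodicGaussian` at `θ = π − θ̌`,
`sin(π − θ̌) = sin θ̌`) by pairing the terms `n + 1` and `−n`, `n ≥ 0`. The print states (A.8) for complex `θ̌` in
`𝒟̌ = {|Re θ̌| ≤ π − δ}`; here `θ̌ ∈ ℝ`. [cite: MullerSchiemann1987, Appendix (A.8) p.285] -/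
theorem h_mul_sin_eq_A8 (hγ : 0 < γ) (θc : ℝ) :
    h γ (π - θc) * Real.sin θc = normN' γ * Real.exp (-(γ * θc ^ 2)) *
      (2 * ∑' n : ℕ, (2 * π * ((n : ℝ) + 1 / 2) * Real.sinh (4 * π * γ * ((n : ℝ) + 1 / 2) * θc)
        - θc * Real.cosh (4 * π * γ * ((n : ℝ) + 1 / 2) * θc))
        * Real.exp (-(4 * π ^ 2 * γ * ((n : ℝ) + 1 / 2) ^ 2))) := by
  set F : ℤ → ℝ := fun n => (π - θc - 2 * π * n) * Real.exp (-(γ * (π - θc - 2 * π * n) ^ 2)) with hF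
  have hFs : Summable F := summable_periodicMoment hγ (π - θc)
  have h0 : h γ (π - θc) * Real.sin θc = normN' γ * ∑' n : ℤ, F n := by
    rw [← Real.sin_pi_sub, h_mul_sin_eq_periodicGaussian hγ (π - θc)]
  -- split the ℤ-sum into the pairs (n+1, −n), n ≥ 0
  have h1 : Summable fun n : ℕ => F ((n : ℤ) + 1) :=
    hFs.comp_injective (i := fun n : ℕ => (n : ℤ) + 1) fun a b hab => by simpa using hab
  have h2 : Summable fun n : ℕ => F (-((n : ℤ) + 1)) :=
    hFs.comp_injective (i := fun n : ℕ => -((n : ℤ) + 1)) fun a b hab => by simpa using hab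
  have h3 : Summable fun n : ℕ => F (-(n : ℤ)) :=
    hFs.comp_injective (i := fun n : ℕ => -(n : ℤ)) fun a b hab => by simpa using hab
  have hsplit : ∑' n : ℤ, F n = (∑' n : ℕ, F ((n : ℤ) + 1)) + F 0 + ∑' n : ℕ, F (-((n : ℤ) + 1)) :=
    tsum_of_add_one_of_neg_add_one h1 h2
  have hneg : ∑' n : ℕ, F (-(n : ℤ)) = F 0 + ∑' n : ℕ, F (-((n : ℤ) + 1)) := by
    rw [h3.tsum_eq_zero_add]
    push_cast
    simp
  have hpair : ∀ n : ℕ, F ((n : ℤ) + 1) + F (-(n : ℤ)) = Real.exp (-(γ * θc ^ 2)) *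
      (2 * ((2 * π * ((n : ℝ) + 1 / 2) * Real.sinh (4 * π * γ * ((n : ℝ) + 1 / 2) * θc)
        - θc * Real.cosh (4 * π * γ * ((n : ℝ) + 1 / 2) * θc))
        * Real.exp (-(4 * π ^ 2 * γ * ((n : ℝ) + 1 / 2) ^ 2)))) := by
    intro n
    simp only [hF, Real.sinh_eq, Real.cosh_eq]
    push_cast
    have e1 : Real.exp (-(γ * (π - θc - 2 * π * ((n : ℝ) + 1)) ^ 2))
        = Real.exp (-(γ * θc ^ 2)) * (Real.exp (-(4 * π * γ * ((n : ℝ) + 1 / 2) * θc))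
          * Real.exp (-(4 * π ^ 2 * γ * ((n : ℝ) + 1 / 2) ^ 2))) := by
      rw [← Real.exp_add, ← Real.exp_add]; congr 1; ring
    have e2 : Real.exp (-(γ * (π - θc - 2 * π * (-(n : ℝ))) ^ 2))
        = Real.exp (-(γ * θc ^ 2)) * (Real.exp (4 * π * γ * ((n : ℝ) + 1 / 2) * θc)
          * Real.exp (-(4 * π ^ 2 * γ * ((n : ℝ) + 1 / 2) ^ 2))) := by
      rw [← Real.exp_add, ← Real.exp_add]; congr 1; ring
    rw [e1, e2]
    ring
  have h13 : Summable fun n : ℕ => F ((n : ℤ) + 1) + F (-(n : ℤ)) := h1.add h3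
  rw [h0, hsplit, add_assoc, ← hneg, ← h1.tsum_add h3, tsum_congr hpair, tsum_mul_left, tsum_mul_left]
  ring

/-- The series of (A.8) converges. [cite: MullerSchiemann1987, Appendix (A.8) p.285] -/
theorem summable_A8_term (hγ : 0 < γ) (θc : ℝ) :
    Summable fun n : ℕ => (2 * π * ((n : ℝ) + 1 / 2) * Real.sinh (4 * π * γ * ((n : ℝ) + 1 / 2) * θc)
        - θc * Real.cosh (4 * π * γ * ((n : ℝ) + 1 / 2) * θc))
        * Real.exp (-(4 * π ^ 2 * γ * ((n : ℝ) + 1 / 2) ^ 2)) := by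
  set F : ℤ → ℝ := fun n => (π - θc - 2 * π * n) * Real.exp (-(γ * (π - θc - 2 * π * n) ^ 2)) with hF
  have hFs : Summable F := summable_periodicMoment hγ (π - θc)
  have h1 : Summable fun n : ℕ => F ((n : ℤ) + 1) :=
    hFs.comp_injective (i := fun n : ℕ => (n : ℤ) + 1) fun a b hab => by simpa using hab
  have h3 : Summable fun n : ℕ => F (-(n : ℤ)) :=
    hFs.comp_injective (i := fun n : ℕ => -(n : ℤ)) fun a b hab => by simpa using hab
  have h := ((h1.add h3).mul_left (Real.exp (γ * θc ^ 2) / 2))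
  refine h.congr fun n => ?_
  simp only [hF, Real.sinh_eq, Real.cosh_eq]
  push_cast
  have e1 : Real.exp (-(γ * (π - θc - 2 * π * ((n : ℝ) + 1)) ^ 2))
      = Real.exp (-(γ * θc ^ 2)) * (Real.exp (-(4 * π * γ * ((n : ℝ) + 1 / 2) * θc))
        * Real.exp (-(4 * π ^ 2 * γ * ((n : ℝ) + 1 / 2) ^ 2))) := by
    rw [← Real.exp_add, ← Real.exp_add]; congr 1; ring
  have e2 : Real.exp (-(γ * (π - θc - 2 * π * (-(n : ℝ))) ^ 2))
      = Real.exp (-(γ * θc ^ 2)) * (Real.exp (4 * π * γ * ((n : ℝ) + 1 / 2) * θc)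
        * Real.exp (-(4 * π ^ 2 * γ * ((n : ℝ) + 1 / 2) ^ 2))) := by
    rw [← Real.exp_add, ← Real.exp_add]; congr 1; ring
  have e3 : Real.exp (γ * θc ^ 2) * Real.exp (-(γ * θc ^ 2)) = 1 := by
    rw [← Real.exp_add, add_neg_cancel, Real.exp_zero]
  rw [e1, e2]
  have : Real.exp (γ * θc ^ 2) / 2 *
      ((π - θc - 2 * π * ((n : ℝ) + 1)) * (Real.exp (-(γ * θc ^ 2)) * (Real.exp (-(4 * π * γ * ((n : ℝ) + 1 / 2) * θc))
        * Real.exp (-(4 * π ^ 2 * γ * ((n : ℝ) + 1 / 2) ^ 2))))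
      + (π - θc - 2 * π * (-(n : ℝ))) * (Real.exp (-(γ * θc ^ 2)) * (Real.exp (4 * π * γ * ((n : ℝ) + 1 / 2) * θc)
        * Real.exp (-(4 * π ^ 2 * γ * ((n : ℝ) + 1 / 2) ^ 2)))))
      = (Real.exp (γ * θc ^ 2) * Real.exp (-(γ * θc ^ 2))) * (1 / 2) *
      (((π - θc - 2 * π * ((n : ℝ) + 1)) * Real.exp (-(4 * π * γ * ((n : ℝ) + 1 / 2) * θc))
        + (π - θc - 2 * π * (-(n : ℝ))) * Real.exp (4 * π * γ * ((n : ℝ) + 1 / 2) * θc))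
        * Real.exp (-(4 * π ^ 2 * γ * ((n : ℝ) + 1 / 2) ^ 2))) := by ring
  rw [this, e3]
  ring

end A8

/-! ## §4 (A.11) on the real axis: `h(θ) ≤ e^{−γπ(π−2δ) − γθ̌² + O(ln γ)}` for `|θ̌| ≤ δ`, `γ ≥ 1` -/

section A11

variable {γ : ℝ}

/-- The `n ≥ 1` constant of the real-axis (A.11): `M₁₁ = Σ_{n≥0} (1 + 8π²(n + 3/2)²) e^{−π²(n+1)}`. [folklore] -/
noncomputable def MA11 : ℝ := ∑' n : ℕ, (1 + 8 * π ^ 2 * ((n : ℝ) + 3 / 2) ^ 2) * Real.exp (-(π ^ 2 * ((n : ℝ) + 1)))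

/-- The series `M₁₁` converges. [folklore] -/
private theorem summable_MA11_term :
    Summable fun n : ℕ => (1 + 8 * π ^ 2 * ((n : ℝ) + 3 / 2) ^ 2) * Real.exp (-(π ^ 2 * ((n : ℝ) + 1))) := by
  have hr : 0 < π ^ 2 := by positivity
  have h0 := (summable_nat_add_iff 1).mpr (Real.summable_pow_mul_exp_neg_nat_mul 0 hr)
  have h1 := (summable_nat_add_iff 1).mpr (Real.summable_pow_mul_exp_neg_nat_mul 1 hr)
  have h2 := (summable_nat_add_iff 1).mpr (Real.summable_pow_mul_exp_neg_nat_mul 2 hr)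
  refine (((h0.mul_left (1 + 2 * π ^ 2)).add (h1.mul_left (8 * π ^ 2))).add (h2.mul_left (8 * π ^ 2))).congr
    fun n => ?_
  push_cast
  ring_nf

/-- `M₁₁ ≥ 0`. [folklore] -/
private theorem MA11_nonneg : 0 ≤ MA11 := by
  unfold MA11
  exact tsum_nonneg fun n => by positivity

/-- The termwise estimate behind (A.11) on the real axis: for `γ ≥ 1`, `0 < δ ≤ π/2`, `|θ̌| ≤ δ` and `m = n + ½`,
`|2πm sinh(4πγmθ̌) − θ̌ cosh(4πγmθ̌)| e^{−4π²γm²} ≤ |θ̌| e^{−γπ(π−2δ)} · c_n(γ)` with `c_0(γ) = 1 + 2π²γ` and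
`c_n(γ) ≤ (1 + 8π²(n+½)²) e^{−π²n}` for `n ≥ 1` (`4πm(πm − δ) − π(π − 2δ) = 4πn(π(n+1) − δ) ≥ 2π²n`).
[cite: MullerSchiemann1987, Appendix (A.11) p.285] -/
private theorem abs_A8_term_le (hγ : 1 ≤ γ) {δ θc : ℝ} (hδ : 0 < δ) (hδ2 : δ ≤ π / 2) (hθc : |θc| ≤ δ) (n : ℕ) :
    |(2 * π * ((n : ℝ) + 1 / 2) * Real.sinh (4 * π * γ * ((n : ℝ) + 1 / 2) * θc)
        - θc * Real.cosh (4 * π * γ * ((n : ℝ) + 1 / 2) * θc))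
        * Real.exp (-(4 * π ^ 2 * γ * ((n : ℝ) + 1 / 2) ^ 2))|
      ≤ |θc| * Real.exp (-(γ * π * (π - 2 * δ))) *
        ((1 + 8 * π ^ 2 * γ * ((n : ℝ) + 1 / 2) ^ 2) * Real.exp (-(2 * π ^ 2 * n * γ))) := by
  have hπ : 0 < π := Real.pi_pos
  have hγ0 : 0 < γ := by linarith
  set m : ℝ := (n : ℝ) + 1 / 2 with hm
  have hm0 : 0 < m := by rw [hm]; positivity
  have hn0 : (0 : ℝ) ≤ n := n.cast_nonneg
  set y : ℝ := 4 * π * γ * m * θc with hy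
  -- |bracket| ≤ |θc| (1 + 8π²γm²) cosh y
  have h1 : |2 * π * m * Real.sinh y - θc * Real.cosh y| ≤ |θc| * (1 + 8 * π ^ 2 * γ * m ^ 2) * Real.cosh y := by
    have hs := abs_sinh_le_abs_mul_cosh y
    have hyabs : |y| = 4 * π * γ * m * |θc| := by
      rw [hy, abs_mul, abs_of_pos (by positivity : (0:ℝ) < 4 * π * γ * m)]
    calc |2 * π * m * Real.sinh y - θc * Real.cosh y|
        ≤ |2 * π * m * Real.sinh y| + |θc * Real.cosh y| := abs_sub _ _
      _ = 2 * π * m * |Real.sinh y| + |θc| * Real.cosh y := by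
          rw [abs_mul (2 * π * m) (Real.sinh y), abs_mul θc (Real.cosh y),
            abs_of_pos (by positivity : (0:ℝ) < 2 * π * m), abs_of_pos (Real.cosh_pos _)]
      _ ≤ 2 * π * m * (|y| * Real.cosh y) + |θc| * Real.cosh y := by gcongr
      _ = |θc| * (1 + 8 * π ^ 2 * γ * m ^ 2) * Real.cosh y := by rw [hyabs]; ring
  -- cosh y · e^{−4π²γm²} ≤ e^{4πγm δ − 4π²γ m²}
  have h2 : Real.cosh y * Real.exp (-(4 * π ^ 2 * γ * m ^ 2))
      ≤ Real.exp (4 * π * γ * m * δ - 4 * π ^ 2 * γ * m ^ 2) := by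
    have hc : Real.cosh y ≤ Real.exp (4 * π * γ * m * δ) := by
      refine (cosh_le_exp_abs y).trans (Real.exp_le_exp.mpr ?_)
      rw [hy, abs_mul, abs_of_pos (by positivity : (0:ℝ) < 4 * π * γ * m)]
      exact mul_le_mul_of_nonneg_left hθc (by positivity)
    calc Real.cosh y * Real.exp (-(4 * π ^ 2 * γ * m ^ 2))
        ≤ Real.exp (4 * π * γ * m * δ) * Real.exp (-(4 * π ^ 2 * γ * m ^ 2)) :=
          mul_le_mul_of_nonneg_right hc (Real.exp_pos _).le
      _ = Real.exp (4 * π * γ * m * δ - 4 * π ^ 2 * γ * m ^ 2) := by rw [← Real.exp_add, sub_eq_add_neg]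
  -- the exponent: 4πγmδ − 4π²γm² ≤ −γπ(π−2δ) − 2π²nγ
  have h3 : 4 * π * γ * m * δ - 4 * π ^ 2 * γ * m ^ 2 ≤ -(γ * π * (π - 2 * δ)) + -(2 * π ^ 2 * n * γ) := by
    rw [hm]
    -- difference = −γ·4πn(π(n+1) − δ) + … ≤ −γ 2π² n  since π(n+1) − δ ≥ π/2 (n+1) ≥ ... we use δ ≤ π/2
    have hk : 2 * π ^ 2 * (n : ℝ) ≤ 4 * π * n * (π * (n + 1) - δ) := by
      have : π / 2 ≤ π * ((n : ℝ) + 1) - δ := by nlinarith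
      nlinarith [mul_nonneg (by positivity : (0:ℝ) ≤ 4 * π * n) (sub_nonneg.mpr this)]
    have hid : 4 * π * γ * ((n : ℝ) + 1 / 2) * δ - 4 * π ^ 2 * γ * ((n : ℝ) + 1 / 2) ^ 2
        = -(γ * π * (π - 2 * δ)) - γ * (4 * π * n * (π * (n + 1) - δ)) := by ring
    rw [hid]
    nlinarith [mul_le_mul_of_nonneg_left hk hγ0.le]
  have hE : Real.exp (4 * π * γ * m * δ - 4 * π ^ 2 * γ * m ^ 2)
      ≤ Real.exp (-(γ * π * (π - 2 * δ))) * Real.exp (-(2 * π ^ 2 * n * γ)) := by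
    rw [← Real.exp_add]; exact Real.exp_le_exp.mpr h3
  -- assemble
  have hw : 0 ≤ Real.exp (-(4 * π ^ 2 * γ * m ^ 2)) := (Real.exp_pos _).le
  rw [abs_mul, abs_of_nonneg hw]
  calc |2 * π * m * Real.sinh y - θc * Real.cosh y| * Real.exp (-(4 * π ^ 2 * γ * m ^ 2))
      ≤ |θc| * (1 + 8 * π ^ 2 * γ * m ^ 2) * Real.cosh y * Real.exp (-(4 * π ^ 2 * γ * m ^ 2)) :=
        mul_le_mul_of_nonneg_right h1 hw
    _ = |θc| * (1 + 8 * π ^ 2 * γ * m ^ 2) * (Real.cosh y * Real.exp (-(4 * π ^ 2 * γ * m ^ 2))) := by ring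
    _ ≤ |θc| * (1 + 8 * π ^ 2 * γ * m ^ 2) *
          (Real.exp (-(γ * π * (π - 2 * δ))) * Real.exp (-(2 * π ^ 2 * n * γ))) :=
        mul_le_mul_of_nonneg_left (h2.trans hE) (by positivity)
    _ = _ := by ring

/-- The weights summed: for `γ ≥ 1`, `Σ_n (1 + 8π²γ(n+½)²) e^{−2π²nγ} ≤ (1 + 2π²γ) + M₁₁` (the `n = 0` term is linear in
`γ`; for `n ≥ 1`, `γ e^{−2π²nγ} ≤ e^{−π²n}`). [folklore] -/
private theorem tsum_A11_weights_le (hγ : 1 ≤ γ) :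
    ∑' n : ℕ, (1 + 8 * π ^ 2 * γ * ((n : ℝ) + 1 / 2) ^ 2) * Real.exp (-(2 * π ^ 2 * n * γ))
      ≤ (1 + 2 * π ^ 2 * γ) + MA11 := by
  have hπ : 0 < π := Real.pi_pos
  have hπ3 : (3 : ℝ) < π := Real.pi_gt_three
  have hγ0 : 0 < γ := by linarith
  set g : ℕ → ℝ := fun n => (1 + 8 * π ^ 2 * γ * ((n : ℝ) + 1 / 2) ^ 2) * Real.exp (-(2 * π ^ 2 * n * γ)) with hg
  set b : ℕ → ℝ := fun n => (1 + 8 * π ^ 2 * ((n : ℝ) + 3 / 2) ^ 2) * Real.exp (-(π ^ 2 * ((n : ℝ) + 1))) with hb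
  have hbs : Summable b := summable_MA11_term
  -- termwise for the shifted series: g (n+1) ≤ b n
  have hγexp : ∀ n : ℕ, γ * Real.exp (-(2 * π ^ 2 * ((n : ℝ) + 1) * γ)) ≤ Real.exp (-(π ^ 2 * ((n : ℝ) + 1))) := by
    intro n
    have hn1 : (1 : ℝ) ≤ (n : ℝ) + 1 := by have : (0:ℝ) ≤ n := n.cast_nonneg; linarith
    -- γ e^{−π²(n+1)γ} ≤ 1 and e^{−π²(n+1)γ} ≤ e^{−π²(n+1)}
    have hsplit : Real.exp (-(2 * π ^ 2 * ((n : ℝ) + 1) * γ))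
        = Real.exp (-(π ^ 2 * ((n : ℝ) + 1) * γ)) * Real.exp (-(π ^ 2 * ((n : ℝ) + 1) * γ)) := by
      rw [← Real.exp_add]; congr 1; ring
    have ha : γ * Real.exp (-(π ^ 2 * ((n : ℝ) + 1) * γ)) ≤ 1 := by
      have h := Real.add_one_le_exp (π ^ 2 * ((n : ℝ) + 1) * γ)
      rw [Real.exp_neg, ← div_eq_mul_inv, div_le_one (Real.exp_pos _)]
      have hc : (1 : ℝ) ≤ π ^ 2 * ((n : ℝ) + 1) := by nlinarith
      have : γ ≤ π ^ 2 * ((n : ℝ) + 1) * γ := by nlinarith [mul_le_mul_of_nonneg_right hc hγ0.le]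
      linarith
    have hb' : Real.exp (-(π ^ 2 * ((n : ℝ) + 1) * γ)) ≤ Real.exp (-(π ^ 2 * ((n : ℝ) + 1))) := by
      apply Real.exp_le_exp.mpr
      nlinarith [mul_nonneg (by positivity : (0:ℝ) ≤ π ^ 2 * ((n : ℝ) + 1)) (sub_nonneg.mpr hγ)]
    calc γ * Real.exp (-(2 * π ^ 2 * ((n : ℝ) + 1) * γ))
        = (γ * Real.exp (-(π ^ 2 * ((n : ℝ) + 1) * γ))) * Real.exp (-(π ^ 2 * ((n : ℝ) + 1) * γ)) := by
          rw [hsplit]; ring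
      _ ≤ 1 * Real.exp (-(π ^ 2 * ((n : ℝ) + 1))) :=
          mul_le_mul ha hb' (Real.exp_pos _).le (by norm_num)
      _ = _ := one_mul _
  have hle : ∀ n : ℕ, g (n + 1) ≤ b n := by
    intro n
    simp only [hg, hb]
    push_cast
    have hE1 : Real.exp (-(2 * π ^ 2 * ((n : ℝ) + 1) * γ)) ≤ Real.exp (-(π ^ 2 * ((n : ℝ) + 1))) := by
      apply Real.exp_le_exp.mpr
      have : 0 ≤ π ^ 2 * ((n : ℝ) + 1) := by positivity
      nlinarith [mul_nonneg this (sub_nonneg.mpr hγ)]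
    have := hγexp n
    have h8 : 0 ≤ 8 * π ^ 2 * ((n : ℝ) + 1 + 1 / 2) ^ 2 := by positivity
    calc (1 + 8 * π ^ 2 * γ * ((n : ℝ) + 1 + 1 / 2) ^ 2) * Real.exp (-(2 * π ^ 2 * ((n : ℝ) + 1) * γ))
        = Real.exp (-(2 * π ^ 2 * ((n : ℝ) + 1) * γ))
          + 8 * π ^ 2 * ((n : ℝ) + 1 + 1 / 2) ^ 2 * (γ * Real.exp (-(2 * π ^ 2 * ((n : ℝ) + 1) * γ))) := by ring
      _ ≤ Real.exp (-(π ^ 2 * ((n : ℝ) + 1)))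
          + 8 * π ^ 2 * ((n : ℝ) + 1 + 1 / 2) ^ 2 * Real.exp (-(π ^ 2 * ((n : ℝ) + 1))) := by
          gcongr
      _ = (1 + 8 * π ^ 2 * ((n : ℝ) + 3 / 2) ^ 2) * Real.exp (-(π ^ 2 * ((n : ℝ) + 1))) := by ring
  have hgs1 : Summable fun n => g (n + 1) :=
    Summable.of_nonneg_of_le (fun n => by simp only [hg]; positivity) hle hbs
  have hgs : Summable g := (summable_nat_add_iff 1).mp hgs1
  rw [hgs.tsum_eq_zero_add]
  have hg0 : g 0 = 1 + 2 * π ^ 2 * γ := by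
    simp only [hg, Nat.cast_zero, zero_add, mul_zero, zero_mul, neg_zero, Real.exp_zero, mul_one]
    ring
  rw [hg0]
  have h2 : ∑' n, g (n + 1) ≤ MA11 := by
    rw [MA11]
    exact Summable.tsum_le_tsum hle hgs1 hbs
  linarith

/-- `|Σ (A.8)-terms| ≤ |θ̌| e^{−γπ(π−2δ)} ((1 + 2π²γ) + M₁₁)` for `γ ≥ 1`, `|θ̌| ≤ δ ≤ π/2`.
[cite: MullerSchiemann1987, Appendix (A.11) p.285] -/
private theorem abs_A8_tsum_le (hγ : 1 ≤ γ) {δ θc : ℝ} (hδ : 0 < δ) (hδ2 : δ ≤ π / 2) (hθc : |θc| ≤ δ) :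
    |∑' n : ℕ, (2 * π * ((n : ℝ) + 1 / 2) * Real.sinh (4 * π * γ * ((n : ℝ) + 1 / 2) * θc)
        - θc * Real.cosh (4 * π * γ * ((n : ℝ) + 1 / 2) * θc))
        * Real.exp (-(4 * π ^ 2 * γ * ((n : ℝ) + 1 / 2) ^ 2))|
      ≤ |θc| * Real.exp (-(γ * π * (π - 2 * δ))) * ((1 + 2 * π ^ 2 * γ) + MA11) := by
  have hγ0 : 0 < γ := by linarith
  -- summability of the weights (from the previous proof's ingredients, re-derived cheaply by domination is awkward;
  -- instead use the bound termwise with `tsum_of_norm_bounded` on a HasSum of the majorant)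
  set W : ℕ → ℝ := fun n => (1 + 8 * π ^ 2 * γ * ((n : ℝ) + 1 / 2) ^ 2) * Real.exp (-(2 * π ^ 2 * n * γ)) with hW
  have hWs : Summable W := by
    have hr : 0 < 2 * π ^ 2 * γ := by positivity
    have h0 := Real.summable_pow_mul_exp_neg_nat_mul 0 hr
    have h1 := Real.summable_pow_mul_exp_neg_nat_mul 1 hr
    have h2 := Real.summable_pow_mul_exp_neg_nat_mul 2 hr
    refine (((h0.mul_left (1 + 2 * π ^ 2 * γ)).add (h1.mul_left (8 * π ^ 2 * γ))).add
      (h2.mul_left (8 * π ^ 2 * γ))).congr fun n => ?_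
    simp only [hW]
    ring_nf
  have hmaj := (hWs.mul_left (|θc| * Real.exp (-(γ * π * (π - 2 * δ))))).hasSum
  have h := tsum_of_norm_bounded hmaj (fun n => (Real.norm_eq_abs _).le.trans (abs_A8_term_le hγ hδ hδ2 hθc n))
  rw [Real.norm_eq_abs, tsum_mul_left] at h
  refine h.trans ?_
  exact mul_le_mul_of_nonneg_left (tsum_A11_weights_le hγ) (by positivity)

/-- **(A.11) on the real axis, uniformly in `γ ≥ 1`, explicit:** for `0 < δ ≤ π/2`, `γ ≥ 1` and `|θ̌| ≤ δ`,
`h(π − θ̌) ≤ 2π((1 + 2π²γ) + M₁₁) · e^{−γπ(π−2δ) − γθ̌²}` — the print's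
«|h(θ)| ≤ exp{−γπ(π−2δ) − γ Re θ̌² + O(ln γ)}, |Re θ̌| ≤ δ» (valid for `γ → ∞`) restricted to real `θ̌`, with the
`O(ln γ)` made explicit (`ln(2π(1 + 2π²γ + M₁₁))`). Proof from (A.8): `|Σ| ≤ |θ̌|e^{−γπ(π−2δ)}((1+2π²γ) + M₁₁)`
(`4πγm|θ̌| − 4π²γm² ≤ −γπ(π−2δ) − 2π²nγ`, `m = n + ½`), `𝒩′ ≤ 2`, `θ̌/sin θ̌ ≤ π/2` (Jordan); at `θ̌ = 0` by the strict
decrease of `h` on `[0, π]`. [cite: MullerSchiemann1987, Appendix (A.11) p.285] -/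
theorem h_le_A11 (hγ : 1 ≤ γ) {δ : ℝ} (hδ : 0 < δ) (hδ2 : δ ≤ π / 2) {θc : ℝ} (hθc : |θc| ≤ δ) :
    h γ (π - θc) ≤ 2 * π * ((1 + 2 * π ^ 2 * γ) + MA11) *
      Real.exp (-(γ * π * (π - 2 * δ)) - γ * θc ^ 2) := by
  have hπ : 0 < π := Real.pi_pos
  have hγ0 : 0 < γ := by linarith
  have hM := MA11_nonneg
  have hN := normN'_le_two hγ
  have hN0 : 0 < normN' γ := by rw [normN']; exact mul_pos (by positivity) (normN_pos hγ0)
  set K : ℝ := (1 + 2 * π ^ 2 * γ) + MA11 with hK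
  have hK0 : 0 < K := by rw [hK]; positivity
  -- the case θc ≠ 0
  have main : ∀ t : ℝ, t ≠ 0 → |t| ≤ δ →
      h γ (π - t) ≤ 2 * π * K * Real.exp (-(γ * π * (π - 2 * δ)) - γ * t ^ 2) := by
    intro t ht0 ht
    have htπ : |t| ≤ π / 2 := ht.trans hδ2
    -- sin t / t > 0 and |t| ≤ (π/2)|sin t|
    have hsin_ne : Real.sin t ≠ 0 := by
      intro hs
      have hlt := abs_le.mp htπ
      exact ht0 ((Real.sin_eq_zero_iff_of_lt_of_lt (by linarith) (by linarith)).mp hs)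
    have hA8 := h_mul_sin_eq_A8 hγ0 t
    have hS := abs_A8_tsum_le hγ hδ hδ2 ht
    -- Jordan: |t| ≤ (π/2) |sin t|
    have hjordan : |t| ≤ π / 2 * |Real.sin t| := by
      have hj := Real.mul_le_sin (abs_nonneg t) htπ
      rw [Real.abs_sin_eq_sin_abs_of_abs_le_pi (htπ.trans (by linarith))]
      have : 2 / π * |t| ≤ Real.sin |t| := hj
      rw [div_mul_eq_mul_div, div_le_iff₀ hπ] at this
      linarith
    -- from (A.8): h = 𝒩′ e^{−γt²} · 2Σ / sin t
    have heq : h γ (π - t) = normN' γ * Real.exp (-(γ * t ^ 2)) *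
        (2 * ∑' n : ℕ, (2 * π * ((n : ℝ) + 1 / 2) * Real.sinh (4 * π * γ * ((n : ℝ) + 1 / 2) * t)
          - t * Real.cosh (4 * π * γ * ((n : ℝ) + 1 / 2) * t))
          * Real.exp (-(4 * π ^ 2 * γ * ((n : ℝ) + 1 / 2) ^ 2))) / Real.sin t := by
      rw [← hA8]; field_simp
    have hpos := h_pos hγ0 (π - t)
    rw [heq] at hpos ⊢
    rw [← abs_of_pos hpos, abs_div, abs_mul, abs_mul, abs_mul, abs_of_pos hN0, abs_of_pos (Real.exp_pos _),
      abs_two, div_le_iff₀ (abs_pos.mpr hsin_ne)]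
    calc normN' γ * Real.exp (-(γ * t ^ 2)) * (2 * |∑' n : ℕ, (2 * π * ((n : ℝ) + 1 / 2)
          * Real.sinh (4 * π * γ * ((n : ℝ) + 1 / 2) * t) - t * Real.cosh (4 * π * γ * ((n : ℝ) + 1 / 2) * t))
          * Real.exp (-(4 * π ^ 2 * γ * ((n : ℝ) + 1 / 2) ^ 2))|)
        ≤ 2 * Real.exp (-(γ * t ^ 2)) * (2 * (|t| * Real.exp (-(γ * π * (π - 2 * δ))) * K)) := by
          have h0 : 0 ≤ Real.exp (-(γ * t ^ 2)) * (2 * (|t| * Real.exp (-(γ * π * (π - 2 * δ))) * K)) := by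
            positivity
          have h1 := mul_le_mul_of_nonneg_left hS (by positivity : (0:ℝ) ≤ normN' γ * Real.exp (-(γ * t ^ 2)) * 2)
          nlinarith [h1, h0, Real.exp_pos (-(γ * t ^ 2))]
      _ = (4 * K * Real.exp (-(γ * π * (π - 2 * δ))) * Real.exp (-(γ * t ^ 2))) * |t| := by ring
      _ ≤ (4 * K * Real.exp (-(γ * π * (π - 2 * δ))) * Real.exp (-(γ * t ^ 2))) * (π / 2 * |Real.sin t|) :=
          mul_le_mul_of_nonneg_left hjordan (by positivity)
      _ = 2 * π * K * Real.exp (-(γ * π * (π - 2 * δ)) - γ * t ^ 2) * |Real.sin t| := by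
          rw [show -(γ * π * (π - 2 * δ)) - γ * t ^ 2 = -(γ * π * (π - 2 * δ)) + -(γ * t ^ 2) by ring,
            Real.exp_add]
          ring
  rcases eq_or_ne θc 0 with rfl | hne
  · -- θc = 0: h(π) < h(π − δ), then the bound at θ̌ = δ
    have h1 : π - δ ∈ Set.Icc 0 π := ⟨by linarith, by linarith⟩
    have h2 : π ∈ Set.Icc 0 π := ⟨hπ.le, le_rfl⟩
    have hlt : h γ π < h γ (π - δ) := h_strictAntiOn hγ0 h1 h2 (by linarith)
    have hb := main δ hδ.ne' (by rw [abs_of_pos hδ])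
    have hexp : Real.exp (-(γ * π * (π - 2 * δ)) - γ * δ ^ 2) ≤ Real.exp (-(γ * π * (π - 2 * δ)) - γ * 0 ^ 2) :=
      Real.exp_le_exp.mpr (by nlinarith [sq_nonneg δ])
    rw [sub_zero]
    calc h γ π ≤ h γ (π - δ) := hlt.le
      _ ≤ 2 * π * K * Real.exp (-(γ * π * (π - 2 * δ)) - γ * δ ^ 2) := hb
      _ ≤ 2 * π * K * Real.exp (-(γ * π * (π - 2 * δ)) - γ * 0 ^ 2) :=
          mul_le_mul_of_nonneg_left hexp (by positivity)
  · exact main θc hne hθc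

/-- (A.11) on the real axis in the printed shape: there are constants `A, B` (independent of `γ`) with
`h(π − θ̌) ≤ exp(−γπ(π − 2δ) − γθ̌² + log(A + Bγ))` for all `γ ≥ 1`, `|θ̌| ≤ δ` — «`+ O(ln γ)`».
[cite: MullerSchiemann1987, Appendix (A.11) p.285] -/
theorem h_le_exp_A11 {δ : ℝ} (hδ : 0 < δ) (hδ2 : δ ≤ π / 2) : ∃ A B : ℝ, 0 < A ∧ 0 < B ∧
    ∀ γ : ℝ, 1 ≤ γ → ∀ θc : ℝ, |θc| ≤ δ →
      h γ (π - θc) ≤ Real.exp (-(γ * π * (π - 2 * δ)) - γ * θc ^ 2 + Real.log (A + B * γ)) := by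
  have hπ : 0 < π := Real.pi_pos
  have hM := MA11_nonneg
  refine ⟨2 * π * (1 + MA11), 2 * π * (2 * π ^ 2), by positivity, by positivity, fun γ hγ θc hθc => ?_⟩
  have hK : 0 < 2 * π * (1 + MA11) + 2 * π * (2 * π ^ 2) * γ := by
    have : 0 < γ := by linarith
    positivity
  rw [Real.exp_add, Real.exp_log hK]
  have hle := h_le_A11 hγ hδ hδ2 hθc
  calc h γ (π - θc) ≤ 2 * π * ((1 + 2 * π ^ 2 * γ) + MA11) * Real.exp (-(γ * π * (π - 2 * δ)) - γ * θc ^ 2) := hle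
    _ = Real.exp (-(γ * π * (π - 2 * δ)) - γ * θc ^ 2) * (2 * π * (1 + MA11) + 2 * π * (2 * π ^ 2) * γ) := by
        ring

end A11

/-! ## §5 (v1.1) LEMMA (iv) on the real axis: `h(θ) < exp{−pβ^{1−2α}}` for `β^{−α} < |θ| ≤ π`, `p = 5/8`, `β` large -/

section LemmaIVReal

/-- The print's `β := γ − 1/6 + ρ₁` of Lemma (iv) («large enough»), as a function of `γ`.
[cite: MullerSchiemann1987, Appendix Lemma (iv) p.284] -/
noncomputable def betaIV (γ : ℝ) : ℝ := γ - 1 / 6 + rho1 γ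

/-- `ρ₁(γ) → 0` (`γ → ∞`), from `|ρ₁| ≤ 2C_b(1)γ³e^{−4π²γ}`. [cite: MullerSchiemann1987, Appendix Lemma (iii) p.284] -/
theorem tendsto_rho1_zero : Tendsto rho1 atTop (𝓝 0) := by
  have hπ : 0 < π := Real.pi_pos
  have hc : 0 < 4 * π ^ 2 := by positivity
  -- (4π²γ)³ e^{−4π²γ} → 0, hence γ³ e^{−4π²γ} → 0
  have h1 : Tendsto (fun γ : ℝ => (4 * π ^ 2 * γ) ^ 3 * Real.exp (-(4 * π ^ 2 * γ))) atTop (𝓝 0) :=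
    (tendsto_pow_mul_exp_neg_atTop_nhds_zero 3).comp (tendsto_id.const_mul_atTop hc)
  have h2 : Tendsto (fun γ : ℝ => 2 * Cb 1 * ((4 * π ^ 2)⁻¹ ^ 3 * ((4 * π ^ 2 * γ) ^ 3 * Real.exp (-(4 * π ^ 2 * γ)))))
      atTop (𝓝 0) := by
    have := (h1.const_mul ((4 * π ^ 2)⁻¹ ^ 3)).const_mul (2 * Cb 1)
    simpa using this
  have h3 : ∀ γ : ℝ, 2 * Cb 1 * ((4 * π ^ 2)⁻¹ ^ 3 * ((4 * π ^ 2 * γ) ^ 3 * Real.exp (-(4 * π ^ 2 * γ))))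
      = 2 * Cb 1 * γ ^ 3 * Real.exp (-(4 * π ^ 2 * γ)) := by
    intro γ; field_simp
  simp_rw [h3] at h2
  refine squeeze_zero_norm' ?_ h2
  filter_upwards [eventually_ge_atTop (1 : ℝ)] with γ hγ
  rw [Real.norm_eq_abs]
  exact abs_rho1_le hγ

/-- **APPENDIX LEMMA (iv) ON THE REAL AXIS.** For `0 < α < ½` (print: `3/7 ≤ α < ½`, Sect. 3 (3.5)) there is `γ₀` such
that for all `γ ≥ γ₀`, with `β = γ − 1/6 + ρ₁(γ)` (`betaIV`), every real `θ` with `β^{−α} < |θ| ≤ π` has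
**`h(θ) < exp{−pβ^{1−2α}}`, `p = 5/8`** — the print's «in {|θ| > β^{−α}, |Re θ| ≤ π, |Im θ| < (κ/2)β^{−α}},
|h(θ)| < exp{β(Im θ)² − pβ^{1−2α}} with a constant p = 5/8 and β := γ − 1/6 + ρ₁ large enough», restricted to `Im θ = 0`.
Proof as printed («From these bounds follows (iv)»): (A.10) on `|θ| ≤ 3π/4` gives `h ≤ e^{A − γθ²} < e^{A − γβ^{−2α}}
≤ e^{A − β^{1−2α}} ≤ e^{−(5/8)β^{1−2α}}` once `(3/8)β^{1−2α} ≥ A` (`γ ≥ β`, i.e. `ρ₁ ≤ 1/6`); (A.11) with `δ = π/4` on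
`3π/4 < |θ| ≤ π` gives `h ≤ e^{−γπ²/2 + log(A′ + B′γ)} < e^{−(5/8)γ} ≤ e^{−(5/8)β^{1−2α}}` for `γ` large (`β^{1−2α} ≤ β ≤ γ`).
[cite: MullerSchiemann1987, Appendix Lemma (iv) p.284, proof p.285 L.21–22] -/
theorem h_lt_exp_iv_real {α : ℝ} (hα0 : 0 < α) (hα : α < 1 / 2) :
    ∃ γ₀ : ℝ, ∀ γ : ℝ, γ₀ ≤ γ → ∀ θ : ℝ, (betaIV γ) ^ (-α) < |θ| → |θ| ≤ π →
      h γ θ < Real.exp (-(5 / 8) * (betaIV γ) ^ (1 - 2 * α)) := by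
  have hπ : 0 < π := Real.pi_pos
  have hπ3 : (3 : ℝ) < π := Real.pi_gt_three
  have hδ : (0 : ℝ) < π / 4 := by positivity
  obtain ⟨A, hA⟩ := h_le_exp_A10 hδ (by linarith : π / 4 < π)
  obtain ⟨A', B', hA'0, hB'0, hA'⟩ := h_le_exp_A11 hδ (by linarith : π / 4 ≤ π / 2)
  have he : 0 < 1 - 2 * α := by linarith
  -- the eventual conditions on γ
  have ev1 : ∀ᶠ γ : ℝ in atTop, |rho1 γ| ≤ 1 / 6 := by
    have := tendsto_rho1_zero
    have h := (this.abs).eventually (gt_mem_nhds (show |(0:ℝ)| < 1 / 6 by norm_num))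
    exact h.mono fun γ hγ => hγ.le
  have ev2 : ∀ᶠ γ : ℝ in atTop, 8 / 3 * (|A| + 1) ≤ (γ - 1 / 3) ^ (1 - 2 * α) := by
    have ht : Tendsto (fun γ : ℝ => (γ - 1 / 3) ^ (1 - 2 * α)) atTop atTop :=
      (tendsto_rpow_atTop he).comp (tendsto_atTop_add_const_right _ _ tendsto_id)
    exact ht.eventually_ge_atTop _
  have ev3 : ∀ᶠ γ : ℝ in atTop, A' / B' + Real.log B' + 1 ≤ γ := eventually_ge_atTop _
  have ev4 : ∀ᶠ γ : ℝ in atTop, (2 : ℝ) ≤ γ := eventually_ge_atTop _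
  obtain ⟨γ₀, hγ₀⟩ := (((ev1.and ev2).and ev3).and ev4).exists_forall_of_atTop
  refine ⟨γ₀, fun γ hγ θ hθlow hθπ => ?_⟩
  obtain ⟨⟨⟨h1, h2⟩, h3⟩, h4⟩ := hγ₀ γ hγ
  have hγ1 : (1 : ℝ) ≤ γ := by linarith
  have hγ0 : 0 < γ := by linarith
  -- β and its position relative to γ
  set β : ℝ := betaIV γ with hβdef
  have hρ := abs_le.mp h1
  have hβγ : β ≤ γ := by rw [hβdef, betaIV]; linarith
  have hβlow : γ - 1 / 3 ≤ β := by rw [hβdef, betaIV]; linarith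
  have hβ1 : 1 ≤ β := by linarith
  have hβ0 : 0 < β := by linarith
  -- powers of β
  have hpow1 : β ^ (1 - 2 * α) ≤ β := by
    have := Real.rpow_le_rpow_of_exponent_le hβ1 (show 1 - 2 * α ≤ 1 by linarith)
    rwa [Real.rpow_one] at this
  have hpow2 : 8 / 3 * (|A| + 1) ≤ β ^ (1 - 2 * α) :=
    h2.trans (Real.rpow_le_rpow (by linarith) hβlow he.le)
  have hpow3 : β * β ^ (-(2 * α)) = β ^ (1 - 2 * α) := by
    rw [show (1 - 2 * α) = 1 + -(2 * α) by ring, Real.rpow_add hβ0, Real.rpow_one]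
  have hθpos : 0 < |θ| := (Real.rpow_pos_of_pos hβ0 _).trans hθlow
  -- θ² > β^{−2α}
  have hsq : β ^ (-(2 * α)) < θ ^ 2 := by
    have h0 : 0 ≤ β ^ (-α) := (Real.rpow_pos_of_pos hβ0 _).le
    have := mul_lt_mul'' hθlow hθlow h0 h0
    rw [← Real.rpow_add hβ0, ← sq, sq_abs] at this
    have e : -(2 * α) = -α + -α := by ring
    rw [e]
    exact this
  -- evenness: h γ θ = h γ |θ|
  have heven : h γ θ = h γ |θ| := by
    rcases abs_choice θ with hc | hc
    · rw [hc]
    · rw [hc, h_neg hγ0]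
  rw [heven]
  by_cases hcase : |θ| ≤ π - π / 4
  · -- Case A: (A.10)
    have hb := hA γ hγ1 |θ| (by rwa [abs_abs])
    refine lt_of_le_of_lt hb (Real.exp_lt_exp.mpr ?_)
    rw [sq_abs]
    -- −γθ² + A < −(5/8)β^{1−2α}
    have hγθ : β ^ (1 - 2 * α) < γ * θ ^ 2 := by
      calc β ^ (1 - 2 * α) = β * β ^ (-(2 * α)) := hpow3.symm
        _ ≤ γ * β ^ (-(2 * α)) := mul_le_mul_of_nonneg_right hβγ (Real.rpow_pos_of_pos hβ0 _).le
        _ < γ * θ ^ 2 := mul_lt_mul_of_pos_left hsq hγ0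
    have hAle : A ≤ |A| := le_abs_self A
    linarith [hpow2, hγθ, hAle]
  · -- Case B: (A.11) with δ = π/4
    have hcase : π - π / 4 < |θ| := lt_of_not_ge hcase
    obtain ⟨θc, hθc⟩ : ∃ θc : ℝ, θc = π - |θ| := ⟨_, rfl⟩
    have hθc0 : 0 ≤ θc := by rw [hθc]; linarith
    have hθcle : |θc| ≤ π / 4 := by rw [abs_of_nonneg hθc0, hθc]; linarith
    have hrew : |θ| = π - θc := by rw [hθc]; ring
    have hb := hA' γ hγ1 θc hθcle
    rw [hrew]
    refine lt_of_le_of_lt hb (Real.exp_lt_exp.mpr ?_)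
    -- −γπ(π − π/2) − γθc² + log(A′ + B′γ) < −(5/8)β^{1−2α}
    have hlog : Real.log (A' + B' * γ) ≤ A' / B' + γ - 1 + Real.log B' := by
      have hx : 0 < A' / B' + γ := by positivity
      have hm : B' * (A' / B' + γ) = A' + B' * γ := by
        field_simp
      have h1' : Real.log (A' + B' * γ) = Real.log B' + Real.log (A' / B' + γ) := by
        rw [← hm, Real.log_mul hB'0.ne' hx.ne']
      have h2' := Real.log_le_sub_one_of_pos hx
      linarith
    have hquad : 0 ≤ γ * θc ^ 2 := by positivity
    have hp : γ * π * (π - 2 * (π / 4)) = γ * π ^ 2 / 2 := by ring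
    rw [hp]
    have hπ2 : (9 : ℝ) < π ^ 2 := by nlinarith [hπ3]
    have hγπ : γ * 9 ≤ γ * π ^ 2 := mul_le_mul_of_nonneg_left hπ2.le hγ0.le
    -- (5/8)β^{1-2α} ≤ (5/8) γ
    have h58 : (5 / 8 : ℝ) * β ^ (1 - 2 * α) ≤ 5 / 8 * γ := by linarith [hpow1, hβγ]
    linarith [hlog, hquad, h58, h3, hγπ]

end LemmaIVReal

end HeatKernel

end MullerSchiemann1987

end Literature.MathematicalPhysics.QuantumFieldTheory
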